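import Summits.QuantumFields.YangMills.Theorems.BalabanUVNodesN13Cor3MargDensityVersionNotDeterminedAtRecord13
import Summits.QuantumFields.YangMills.Theorems.BalabanUVNodesK1V6Defs

/-!
# BalabanUVNodes ∕ N13 — LOCATED KERNEL CERTIFICATE AT THE DECIDING ITEM K1⁸: the point values pinned by the (B) conjunct sit on ONE
# `θ`-FREE `dV₁`-NULL SET — the UNIT FIBRE `{V′ | M(V′) = 1}` of the level-1 averaging — and the very `∃`-statement Mathlib's
# `Measure.rnDeriv` applies `Classical.choose` to has, for every family and every `K`, witnesses vanishing identically on that fibre;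
# hence `K0⁷ ∧ K1⁸` (the first two hypotheses of `closes`) is contradicted by ONE hypothesis on the values of `Classical.choose`

Cell `pub-ymgap` (HUMAN RULING D-0062 Track A ∕ D-0149 width), WIDTH SEAT `pub-ymgap-dag-n13-w1` (gen 5, CLAIM-1, INBOX l.≈32022), successor key
K1⁸ `StabilityBRunRowsAtRecordR13SepCoPH` = stmt-QuantumFields-26907 (dag-lead KEY MAP l.≈31754; this lineage's earlier key K1⁷ stmt-QuantumFields-20542 is
`aside` since route rev 27); `--kind proof --supports … --as helper`; count-neutral; LOCATED reading for plan g84 (op 5 «v7ᴿ» skeleton), CRIT-1, dag-lead's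
`RECORD13-CLOSABILITY-GATE.md`, the chair — NO re-cut is made by this seat.
[III] = [Balaban1988Convergent], [B16] = [Balaban1989LargeFieldII], [I] = [Balaban1987RG1].

WHAT (kernel theorems; the READING below is prose).
* §1 [folklore, any measurable space, `μ ν` with `HaveLebesgueDecomposition μ ν`].  Mathlib's `Measure.rnDeriv μ ν` is BY DEFINITION
  `(Classical.choose h.lebesgue_decomposition).2` for the `∃`-statement `h.lebesgue_decomposition : ∃ p : Measure α × (α → ℝ≥0∞), Measurable p.2 ∧
  p.1 ⟂ₘ ν ∧ μ = p.1 + ν.withDensity p.2` (`rnDeriv_eq_choose`, `singularPart_eq_choose` — the `irreducible_def`s unfolded).  For every measurable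
  `ν`-NULL SET `A` that `∃`-statement has a witness whose density VANISHES IDENTICALLY ON `A` (and is `=ᵐ[ν]` the chosen one, with the same singular
  part: `exists_lebesgueDecomposition_witness_eq_zero_on_null`), and one taking ANY prescribed value on `A` (`…_eq_const_on_null`).
* §2 [record, `N = 2`, every torus `F.P K` with `K ≥ 1`].  THE UNIT FIBRE `{V′ : cfg_K^{(1)} | (avOfRecord F 2 K 1).avg V′ = 1}` of the level-1 block
  averaging is a measurable `dV₁`-NULL set (`fieldMeasure_preimage_avg_one_eq_zero`: `HaarAC` of the exp-mean-log averaging in the standing range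
  `2 ≤ m + K` — the tree's `haarAC_avgFun_expMeanLogSU_SUN` — and «`dV₂` charges no configuration», the sibling seat dag-n13-w2 g4's
  `fieldMeasure_singleton_SU2` (p617654) BY NAME, at level 2), and it CONTAINS THE PINNED POINT `critCfgOfRecord F 2 ν K 1 1` FOR EVERY `ν`
  (`critCfgOfRecord_mem_preimage_avg_one`, this lineage's g4 `avg_critCfgOfRecord_one`: both branches of def-B's `Uk`).
* §3 [record].  For every `F`, `K ≥ 1` the level-0 → 1 `∃`-statement has ONE witness — `θ`-free — vanishing on the whole unit fibre, `=ᵐ[dV₁]` the chosen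
  version, with the chosen singular part, and reproducing the push-forward law `dV₁.withDensity p.2 = dU₀.map M` exactly
  (`exists_lebesgueDecomposition_witness_eq_zero_on_unitFibre`); the `Classical.choose` display of `avgDensity` is the sibling's `avgDensity_avOfRecord_eq_choose`.
* §4 [the items].  `Record13SepCoPHInhabited ∧ StabilityBRunRowsAtRecordR13SepCoPH` (K0⁷ ∧ K1⁸, hypotheses `h0 h1` of `Theses.BalabanUVNodes.closes`) ⟹ for
  EVERY family `F` some `K ≥ 1` and some point OF THE NULL UNIT FIBRE at which the chosen density is `≠ 0`
  (`exists_avgDensity_ne_zero_on_unitFibre_of_record13_of_stabilityBRunRows`, with the bare `Classical.choose` display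
  `exists_choose_ne_zero_on_unitFibre_of_record13_of_stabilityBRunRows`); contrapositively ONE hypothesis on those chosen values — «for some family the
  chosen level-0 → 1 densities vanish on the unit fibres» — REFUTES `K0⁷ ∧ K1⁸` (`not_record13_and_stabilityBRunRows_of_avgDensity_eq_zero_on_unitFibre`);
  the K1⁸-alone and K1⁷ (`aside`) forms modulo K0⁷'s conclusion at that family (`not_stabilityBRunRows_of_…`, `not_stabilityBAtRecord_of_…`).
* §5 [the registered stubs].  The two registered stub TEXTS of K1⁸'s skeleton «v7ᴿ» (= K1 v6's `stub_nodes13PWS` ∕ `stub_runRows13PWS`, byte-identical; tree names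
  `K1V6Defs.Inhabited13 ∕ NodesAtSomeRecord13PWS ∕ RunRowsAtSomeRecord13PWS`) compose to K1⁷ BY NAME (`K1V6Defs.stabilityBAtRecordR13SepCoPH_of_stubTexts`), hence JOINTLY inherit
  the pin: the same hypothesis at a family with `Inhabited13 F` refutes their conjunction (`not_stubTexts_of_avgDensity_eq_zero_on_unitFibre`).

RELATION TO THE SIBLING FILE p617654 (dag-n13-w2 g4, `…N13Cor3MargDensityVersionNotDeterminedAtRecord13`, imported): that file is the PER-POINT non-determination
(witnesses with EVERY value at ONE configuration `V₁`; `dV`-singletons null); its `fieldMeasure_singleton_SU2` and `avgDensity_avOfRecord_eq_choose` are used BY NAME,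
nothing of it is restated.  WHY THE FIBRE (what gen 4's p610399 ∕ a per-point competitor do not give).  K1⁸ reads `∃ θ`; the pinned point `V₁(θ) = critCfgOfRecord F 2 θ.ν P.K 1 1` MOVES
with `θ.ν` (def-B's chosen minimiser `Uk … ν.εreg`), so a competitor witness vanishing at ONE `V₁(θ)` says nothing about the next `θ`.  The unit fibre is
chosen BEFORE `θ`: it is `θ`-free, `dV₁`-null, and carries every `V₁(θ)`; one competitor per `(F, K)` defeats the pin for all `θ` at once.

READING (prose; hedged; a kernel theorem cannot state unprovability).  Every theorem of Lean about `Classical.choose h` that does not itself mention that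
choice is a theorem about an ARBITRARY witness of `h` (the standing reading of Mathlib's `rnDeriv` API — all its lemmas are `ν`-a.e. — and of this cell's record:
node00-def-T ERRATUM-VERSION l.11075 «POINTWISE DETERMINACY ✗ … `margDensity = rnNN`», dag-ref-D RIDER №6 (b), dag-n13-b TS-4, dag-n23-b (H-h)).  §3 exhibits,
for every `(F, K)`, a witness of the SAME `∃`-statement on which §4's pinned non-vanishing FAILS uniformly in `θ`; §4 shows that `K0⁷ ∧ K1⁸` AS TYPED asserts the
chosen witness is not of that kind for any family.  Granting the standing reading, the cone `closes h0 h1 h2 h3 : … → BalabanLadder.UV` cannot be fed with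
these two item texts: whatever Bałaban's estimates give, they give it for every version, and some version refutes (B) as typed at every `θ`.  The VERSION-FREE
faces of [III] Cor. 3 (2.50) that the rung's (G2)∕(G5) socket actually reads — `dV_K`-a.e., as inequalities of measures, or ONE integrated inequality per tuned run
`e^{−Em|T₁^{(K)}|}·c_low(K) ≤ ∫ρ_K dV_K` (this lineage's g3∕g4 sockets p602865 · p613095 ∕ p615249 `lowEnvelope_of_integratedLowerAtTop`) — or a density tower built
from def-T's `contVersion` (`Node00/ContinuousTransportOfRecord`, p423705) are the currencies an estimate can reach.  The word is the planners'.

HONEST FRAMING.  Count-neutral kernel measure theory ([folklore]: null-set modification of a Lebesgue-decomposition witness; product-Haar nullity of a fibre) and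
by-name composition with gen 4's p610399 and the route decls; nothing of Bałaban's asserted or refuted; K0⁷ ∕ K1⁸ ∕ K1⁷ NEITHER proved NOR refuted (all theorems
are implications FROM the decls or hypothetical refutations MODULO a hypothesis on `Classical.choose`); N13 NOT discharged; no stub closed; counts unmoved (typed
28∕28 · discharged 5∕27, A 5∕28); one finite `𝕋⁴_{L^K}` programme at fixed `ε = L^{−K}`; route R4 closes the CONDITIONAL finite-𝕋⁴ rung `BalabanLadder.UV` only —
the Yang–Mills mass gap (Clay) is NOT proved by any of this; nothing continuum ∕ ℝ⁴ ∕ OS.  No `sorry`, `def`, `instance`, `notation`; standard axioms.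
-/

noncomputable section

open scoped BigOperators ENNReal NNReal Matrix.Norms.L2Operator

namespace Summit.QuantumFields.YangMills.BalabanUVNodes.K1R8VersionPinOnNullUnitFibre

open MeasureTheory
open Literature.MathematicalPhysics.QuantumFieldTheory.Balaban1983to89
open Literature.MathematicalPhysics.QuantumFieldTheory.Balaban1983to89.T4Continuum (T4Family)
open Literature.MathematicalPhysics.QuantumFieldTheory.Balaban1983to89.Node00
open T4AveragingDisintegration (avgDensity jointLaw margDensity)
open Summit.QuantumFields.YangMills.BalabanUVNodes.N13Cor3PinsMargDensityVersionAtRecord13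
  (avg_critCfgOfRecord_one exists_avgDensity_ne_zero_of_endStatementBPrinted_of_window
    exists_avgDensity_ne_zero_of_stabilityBAtRecordR13SepCoPH)
open Summit.QuantumFields.YangMills.BalabanUVNodes.N13Cor3MargDensityVersionNotDeterminedAtRecord13
  (fieldMeasure_singleton_SU2 avgDensity_avOfRecord_eq_choose)

/-! ## §1 [folklore] `Measure.rnDeriv` IS `Classical.choose`; the chosen-from `∃`-statement has witnesses with ANY values on a null set -/

section Generic

variable {α : Type*} [MeasurableSpace α] {μ ν : Measure α}

/-- **Mathlib's Radon–Nikodym derivative is `Classical.choose`**: with `h : HaveLebesgueDecomposition μ ν`,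
`μ.rnDeriv ν = (Classical.choose h.lebesgue_decomposition).2` (the `irreducible_def` `Measure.rnDeriv` unfolded; `dif_pos`). [folklore] -/
theorem rnDeriv_eq_choose [h : μ.HaveLebesgueDecomposition ν] :
    μ.rnDeriv ν = (Classical.choose h.lebesgue_decomposition).2 := by
  rw [Measure.rnDeriv_def, dif_pos h]

/-- … and the singular part is the first component of the same chosen pair. [folklore] -/
theorem singularPart_eq_choose [h : μ.HaveLebesgueDecomposition ν] :
    μ.singularPart ν = (Classical.choose h.lebesgue_decomposition).1 := by
  rw [Measure.singularPart_def, dif_pos h]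

/-- Modifying a function on a `ν`-null set does not change it `ν`-a.e. (indicator of the complement). [folklore] -/
theorem indicator_compl_ae_eq_of_null {A : Set α} (hA0 : ν A = 0) (f : α → ℝ≥0∞) :
    Aᶜ.indicator f =ᵐ[ν] f := by
  filter_upwards [measure_eq_zero_iff_ae_notMem.1 hA0] with x hx
  exact Set.indicator_of_mem (Set.mem_compl hx) _

/-- Modifying a function on a `ν`-null set does not change it `ν`-a.e. (piecewise with a constant). [folklore] -/
theorem piecewise_const_ae_eq_of_null {A : Set α} [DecidablePred (· ∈ A)] (hA0 : ν A = 0) (c : ℝ≥0∞) (f : α → ℝ≥0∞) :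
    A.piecewise (fun _ => c) f =ᵐ[ν] f := by
  filter_upwards [measure_eq_zero_iff_ae_notMem.1 hA0] with x hx
  exact Set.piecewise_eq_of_notMem _ _ _ hx

/-- **THE `∃`-STATEMENT BEHIND `Measure.rnDeriv` HAS A WITNESS VANISHING ON ANY GIVEN MEASURABLE `ν`-NULL SET.**  For `A` measurable with `ν A = 0`,
the pair `(μ.singularPart ν, Aᶜ.indicator (μ.rnDeriv ν))` satisfies VERBATIM the body of `HaveLebesgueDecomposition.lebesgue_decomposition` —
`Measurable p.2 ∧ p.1 ⟂ₘ ν ∧ μ = p.1 + ν.withDensity p.2` —, vanishes identically on `A`, is `=ᵐ[ν]` the chosen density and has the chosen singular part.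
(`withDensity` sees only the `ν`-a.e. class: `withDensity_congr_ae`.) [folklore] -/
theorem exists_lebesgueDecomposition_witness_eq_zero_on_null [μ.HaveLebesgueDecomposition ν] {A : Set α}
    (hA : MeasurableSet A) (hA0 : ν A = 0) :
    ∃ p : Measure α × (α → ℝ≥0∞),
      (Measurable p.2 ∧ p.1 ⟂ₘ ν ∧ μ = p.1 + ν.withDensity p.2) ∧
        (∀ x ∈ A, p.2 x = 0) ∧ p.2 =ᵐ[ν] μ.rnDeriv ν ∧ p.1 = μ.singularPart ν := by
  have hae : Aᶜ.indicator (μ.rnDeriv ν) =ᵐ[ν] μ.rnDeriv ν := indicator_compl_ae_eq_of_null hA0 _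
  refine ⟨(μ.singularPart ν, Aᶜ.indicator (μ.rnDeriv ν)), ⟨?_, ?_, ?_⟩, ?_, hae, rfl⟩
  · exact (Measure.measurable_rnDeriv μ ν).indicator hA.compl
  · exact μ.mutuallySingular_singularPart ν
  · show μ = μ.singularPart ν + ν.withDensity (Aᶜ.indicator (μ.rnDeriv ν))
    rw [withDensity_congr_ae hae]
    exact μ.haveLebesgueDecomposition_add ν
  · intro x hx
    show Aᶜ.indicator (μ.rnDeriv ν) x = 0
    exact Set.indicator_of_notMem (fun h : x ∈ Aᶜ => absurd hx h) _

/-- **… AND A WITNESS TAKING ANY PRESCRIBED VALUE `c` ON `A`** (so the chosen-from `∃`-statement leaves every value on `A` open). [folklore] -/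
theorem exists_lebesgueDecomposition_witness_eq_const_on_null [μ.HaveLebesgueDecomposition ν] {A : Set α}
    (hA : MeasurableSet A) (hA0 : ν A = 0) (c : ℝ≥0∞) :
    ∃ p : Measure α × (α → ℝ≥0∞),
      (Measurable p.2 ∧ p.1 ⟂ₘ ν ∧ μ = p.1 + ν.withDensity p.2) ∧
        (∀ x ∈ A, p.2 x = c) ∧ p.2 =ᵐ[ν] μ.rnDeriv ν ∧ p.1 = μ.singularPart ν := by
  classical
  have hae : A.piecewise (fun _ => c) (μ.rnDeriv ν) =ᵐ[ν] μ.rnDeriv ν := piecewise_const_ae_eq_of_null hA0 c _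
  refine ⟨(μ.singularPart ν, A.piecewise (fun _ => c) (μ.rnDeriv ν)), ⟨?_, ?_, ?_⟩, ?_, hae, rfl⟩
  · exact Measurable.piecewise hA measurable_const (Measure.measurable_rnDeriv μ ν)
  · exact μ.mutuallySingular_singularPart ν
  · show μ = μ.singularPart ν + ν.withDensity (A.piecewise (fun _ => c) (μ.rnDeriv ν))
    rw [withDensity_congr_ae hae]
    exact μ.haveLebesgueDecomposition_add ν
  · intro x hx
    show A.piecewise (fun _ => c) (μ.rnDeriv ν) x = c
    exact Set.piecewise_eq_of_mem _ _ _ hx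

/-- **If the chosen density were the vanishing competitor, it would vanish on `A`** — the trivial converse direction recorded for the reading: the property
«`≡ 0` on `A`» is decided by WHICH witness `Classical.choose` returns, both kinds being available (§1). [folklore] -/
theorem rnDeriv_eq_zero_on_of_choose_eq [h : μ.HaveLebesgueDecomposition ν] {A : Set α} {p : Measure α × (α → ℝ≥0∞)}
    (hp : ∀ x ∈ A, p.2 x = 0) (hch : Classical.choose h.lebesgue_decomposition = p) :
    ∀ x ∈ A, μ.rnDeriv ν x = 0 := by
  intro x hx
  rw [rnDeriv_eq_choose, hch]
  exact hp x hx

end Generic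

/-! ## §2 [record, `N = 2`] THE UNIT FIBRE OF THE LEVEL-1 AVERAGING IS A `θ`-FREE `dV₁`-NULL SET CARRYING EVERY PINNED POINT -/

section Fibre

variable (F : T4Family)

/-- Level bookkeeping: on every torus of the family with `1 ≤ K` the standing range `2 ≤ m + K` of the level-1 averaging holds (`m ≥ 1`).
[cite: Balaban1987RG1, (0.1) p.251 (bookkeeping)] -/
theorem two_le_m_add_K {K : ℕ} (hK : 1 ≤ K) : 1 + 1 ≤ (F.P K).m + (F.P K).K := by
  have hm := F.hm
  rw [T4Family.P_K, T4Family.P_m]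
  omega

/-- A singleton of `SU(2)`-configurations is measurable (finite product of standard Borel factors). [folklore] -/
theorem measurableSet_singleton_cfg (P : Params) (j : ℕ) (W : GaugeField P j (SU 2)) :
    MeasurableSet ({W} : Set (GaugeField P j (SU 2))) := by
  haveI : MeasurableSingletonClass (GaugeField P j (SU 2)) :=
    inferInstanceAs (MeasurableSingletonClass (PBond P j → SU 2))
  exact measurableSet_singleton W

/-- The unit fibre `{V′ | M(V′) = 1}` of the level-`j` averaging of record is measurable (measurable averaging, measurable singleton).
[cite: Balaban1987RG1, (0.4) p.253 (bookkeeping)] -/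
theorem measurableSet_preimage_avg_one (K j : ℕ) :
    MeasurableSet {V' : cfgOfRecord F 2 K j | (avOfRecord F 2 K j).avg V' = 1} :=
  (measurableSet_singleton_cfg (F.P K) (j + 1) 1).preimage (avOfRecord_measurable F 2 K j)

/-- **★ THE UNIT FIBRE OF THE LEVEL-1 AVERAGING IS `dV₁`-NULL** (`N = 2`, every `K ≥ 1`): `dV₁ {V′ | (avOfRecord F 2 K 1).avg V′ = 1} = 0`.  PROOF: the
push-forward `dV₁.map M` is absolutely continuous w.r.t. `dV₂` (`HaarAC` of Bałaban's exp-mean-log block averaging in the standing range `2 ≤ m + K`, the tree's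
`haarAC_avgFun_expMeanLogSU_SUN`), and `dV₂{1} = 0`. [cite: Balaban1987RG1, (0.4) p.253; Balaban1985Averaging, (10) p.19 (kernel properties of the tree's averaging and product measure, by name)] -/
theorem fieldMeasure_preimage_avg_one_eq_zero (K : ℕ) (hK : 1 ≤ K) :
    fieldMeasure (F.P K) 1 (SU 2) {V' : cfgOfRecord F 2 K 1 | (avOfRecord F 2 K 1).avg V' = 1} = 0 := by
  have hac : (fieldMeasure (F.P K) 1 (SU 2)).map (avOfRecord F 2 K 1).avg ≪ fieldMeasure (F.P K) (1 + 1) (SU 2) := by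
    rw [avOfRecord_avg]
    exact BlockAveragingEMLFibreLawSUN.haarAC_avgFun_expMeanLogSU_SUN (two_le_m_add_K F hK)
  have h2 : (fieldMeasure (F.P K) 1 (SU 2)).map (avOfRecord F 2 K 1).avg {1} = 0 :=
    hac (fieldMeasure_singleton_SU2 (1 : cfgOfRecord F 2 K (1 + 1)))
  rwa [Measure.map_apply (avOfRecord_measurable F 2 K 1) (measurableSet_singleton_cfg (F.P K) (1 + 1) 1)] at h2

/-- **THE PINNED POINT LIES IN THE UNIT FIBRE, FOR EVERY `ν`**: `(avOfRecord F 2 K 1).avg (critCfgOfRecord F 2 ν K 1 1) = 1` (both branches of def-B's `Uk`; gen 4's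
`avg_critCfgOfRecord_one`). [cite: Balaban1987RG1, (2.3) p.265, (0.4) p.253 (bookkeeping)] -/
theorem critCfgOfRecord_mem_preimage_avg_one (ν : Stage7Numerics) (K : ℕ) (hK : 1 ≤ K) :
    critCfgOfRecord F 2 ν K 1 1 ∈ {V' : cfgOfRecord F 2 K 1 | (avOfRecord F 2 K 1).avg V' = 1} :=
  avg_critCfgOfRecord_one ν K 1 (two_le_m_add_K F hK)

end Fibre

/-! ## §3 [record] THE MARGINAL DENSITY OF RECORD IS `Classical.choose`; ONE `θ`-FREE COMPETITOR PER `(F, K)` VANISHING ON THE UNIT FIBRE -/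

section Record

variable (F : T4Family)

/-- **★★ ONE `θ`-FREE COMPETITOR PER `(F, K)`** (`N = 2`, `K ≥ 1`): the `∃`-statement §3's `Classical.choose` is applied to at the level-0 → 1 step has a witness
`p` — satisfying its body VERBATIM — whose density VANISHES ON THE WHOLE UNIT FIBRE of level 1, is `=ᵐ[dV₁]` the chosen density, has the chosen singular part,
and reproduces the push-forward law `dV₁.withDensity p.2 = dU₀.map M` exactly (def-T's `withDensity_margDensity` under `HaarAC`).  Everything the tree knows
or can know `dV₁`-a.e. about `avgDensity (avOfRecord F 2 K 0).avg` holds of `p.2`; §4's pinned non-vanishing fails for `p.2` at every `θ`.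
[cite: Balaban1985Averaging, (10) p.19; Balaban1987RG1, (0.4) p.253 (kernel properties of the tree's averaging, by name; the modification is folklore)] -/
theorem exists_lebesgueDecomposition_witness_eq_zero_on_unitFibre (K : ℕ) (hK : 1 ≤ K) :
    ∃ p : Measure (cfgOfRecord F 2 K 1) × (cfgOfRecord F 2 K 1 → ℝ≥0∞),
      (Measurable p.2 ∧ p.1 ⟂ₘ fieldMeasure (F.P K) 1 (SU 2) ∧
          (jointLaw (fieldMeasure (F.P K) 0 (SU 2)) (avOfRecord F 2 K 0).avg).fst =
            p.1 + (fieldMeasure (F.P K) 1 (SU 2)).withDensity p.2) ∧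
        (∀ V' ∈ {V' : cfgOfRecord F 2 K 1 | (avOfRecord F 2 K 1).avg V' = 1}, p.2 V' = 0) ∧
        (p.2 =ᵐ[fieldMeasure (F.P K) 1 (SU 2)] fun V' => (avgDensity (avOfRecord F 2 K 0).avg V' : ℝ≥0∞)) ∧
        p.1 = (jointLaw (fieldMeasure (F.P K) 0 (SU 2)) (avOfRecord F 2 K 0).avg).fst.singularPart (fieldMeasure (F.P K) 1 (SU 2)) ∧
        (fieldMeasure (F.P K) 1 (SU 2)).withDensity p.2 = (fieldMeasure (F.P K) 0 (SU 2)).map (avOfRecord F 2 K 0).avg := by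
  obtain ⟨p, hspec, hzero, hae, hsing⟩ :=
    exists_lebesgueDecomposition_witness_eq_zero_on_null
      (μ := (jointLaw (fieldMeasure (F.P K) 0 (SU 2)) (avOfRecord F 2 K 0).avg).fst) (ν := fieldMeasure (F.P K) 1 (SU 2))
      (measurableSet_preimage_avg_one F K 1) (fieldMeasure_preimage_avg_one_eq_zero F K hK)
  -- the chosen density, coerced to `ℝ≥0∞`, is a.e. the `rnDeriv` (it is finite a.e.)
  have hfin : ∀ᵐ V' ∂(fieldMeasure (F.P K) 1 (SU 2)),
      (jointLaw (fieldMeasure (F.P K) 0 (SU 2)) (avOfRecord F 2 K 0).avg).fst.rnDeriv (fieldMeasure (F.P K) 1 (SU 2)) V' < ∞ :=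
    Measure.rnDeriv_lt_top _ _
  have hcoe : (fun V' => (avgDensity (avOfRecord F 2 K 0).avg V' : ℝ≥0∞)) =ᵐ[fieldMeasure (F.P K) 1 (SU 2)]
      (jointLaw (fieldMeasure (F.P K) 0 (SU 2)) (avOfRecord F 2 K 0).avg).fst.rnDeriv (fieldMeasure (F.P K) 1 (SU 2)) := by
    filter_upwards [hfin] with V' hV'
    exact ENNReal.coe_toNNReal hV'.ne
  have hac : (fieldMeasure (F.P K) 0 (SU 2)).map (avOfRecord F 2 K 0).avg ≪ fieldMeasure (F.P K) (0 + 1) (SU 2) :=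
    avOfRecord_haarAC F 2 K 0 hK
  refine ⟨p, hspec, hzero, hae.trans hcoe.symm, hsing, ?_⟩
  calc (fieldMeasure (F.P K) 1 (SU 2)).withDensity p.2
      = (fieldMeasure (F.P K) 1 (SU 2)).withDensity (fun V' => (avgDensity (avOfRecord F 2 K 0).avg V' : ℝ≥0∞)) :=
        withDensity_congr_ae (hae.trans hcoe.symm)
    _ = (fieldMeasure (F.P K) 0 (SU 2)).map (avOfRecord F 2 K 0).avg :=
        T4AveragingDisintegration.withDensity_margDensity _ _ (avOfRecord_measurable F 2 K 0) hac

end Record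

/-! ## §4 [the items] `K0⁷ ∧ K1⁸` PUTS THE CHOSEN DENSITY `≠ 0` SOMEWHERE ON THE NULL UNIT FIBRE; ONE HYPOTHESIS ON `Classical.choose` REFUTES `K0⁷ ∧ K1⁸` -/

section Items

open Summit.QuantumFields.YangMills.Theses.BalabanUVNodes (Record13SepCoPHInhabited StabilityBRunRowsAtRecordR13SepCoPH StabilityBAtRecordR13SepCoPH)

/-- **K1⁸'s CONSEQUENT AT `θ` PINS A NON-ZERO VALUE OF THE CHOSEN DENSITY ON THE NULL UNIT FIBRE** (`N = 2`): from (B) `B16.EndStatementBPrinted (datumOfRecord₁₃SepCoPH F 2 θ h).C`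
and the `K ≥ 1` window at an admissible-threshold `θ`, some `K ≥ 1` and some `V′` with `(avOfRecord F 2 K 1).avg V′ = 1` — a point of a `dV₁`-NULL set — carry
`avgDensity (avOfRecord F 2 K 0).avg V′ ≠ 0` (gen 4's `exists_avgDensity_ne_zero_of_endStatementBPrinted_of_window` + §2).
[cite: Balaban1989LargeFieldII, Thm 1 p.355, (0.1) pp.355–356; Balaban1988Convergent, Cor. 3 (2.50) p.264, (3.1) p.264; Balaban1987RG1, (2.3) p.265, (2.9) p.266 (bookkeeping)] -/
theorem exists_avgDensity_ne_zero_on_unitFibre_of_endStatementBPrinted_of_window {F : T4Family} (θ : Stage13HParams F 2)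
    (h : θ.Provisos₁₃SepCoPH F 2) (hε' : 0 < θ.ε₂₉) (hB : B16.EndStatementBPrinted (datumOfRecord₁₃SepCoPH F 2 θ h).C)
    (hW : ∃ γ₁ : ℝ, 0 < γ₁ ∧ ∀ γ : ℝ, 0 < γ → γ ≤ γ₁ →
      ∃ P : B12.RunParams, 1 ≤ P.K ∧ ((datumOfRecord₁₃SepCoPH F 2 θ h).C P).flow.InInterval γ P.K) :
    ∃ K : ℕ, 1 ≤ K ∧ fieldMeasure (F.P K) 1 (SU 2) {V' : cfgOfRecord F 2 K 1 | (avOfRecord F 2 K 1).avg V' = 1} = 0 ∧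
      ∃ V' ∈ {V' : cfgOfRecord F 2 K 1 | (avOfRecord F 2 K 1).avg V' = 1}, avgDensity (avOfRecord F 2 K 0).avg V' ≠ 0 := by
  obtain ⟨P, hK, hne⟩ := exists_avgDensity_ne_zero_of_endStatementBPrinted_of_window θ h hε' hB hW
  exact ⟨P.K, hK, fieldMeasure_preimage_avg_one_eq_zero F P.K hK, _, critCfgOfRecord_mem_preimage_avg_one F θ.ν P.K hK, hne⟩

/-- **★★★ `K0⁷ ∧ K1⁸` ⟹ FOR EVERY FAMILY THE CHOSEN LEVEL-0 → 1 DENSITY IS `≠ 0` AT SOME POINT OF THE NULL UNIT FIBRE OF SOME TORUS `K ≥ 1`.**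
`Record13SepCoPHInhabited` supplies K1⁸'s antecedent at `F`; K1⁸'s consequent gives an admissible `θ` with (B) and the window; then the previous theorem.
[cite: Balaban1989LargeFieldII, Thm 1 p.355, (0.1) pp.355–356; Balaban1988Convergent, Cor. 3 (2.50) p.264; Balaban1987RG1, (2.3) p.265 (bookkeeping)] -/
theorem exists_avgDensity_ne_zero_on_unitFibre_of_record13_of_stabilityBRunRows
    (h0 : Record13SepCoPHInhabited) (h1 : StabilityBRunRowsAtRecordR13SepCoPH) (F : T4Family) :
    ∃ K : ℕ, 1 ≤ K ∧ fieldMeasure (F.P K) 1 (SU 2) {V' : cfgOfRecord F 2 K 1 | (avOfRecord F 2 K 1).avg V' = 1} = 0 ∧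
      ∃ V' ∈ {V' : cfgOfRecord F 2 K 1 | (avOfRecord F 2 K 1).avg V' = 1}, avgDensity (avOfRecord F 2 K 0).avg V' ≠ 0 := by
  obtain ⟨θ, h, -, hθ, hB, hW, -⟩ := h1 F (h0 F)
  exact exists_avgDensity_ne_zero_on_unitFibre_of_endStatementBPrinted_of_window θ h hθ.ε₂₉_pos hB hW

/-- **★★★ THE SAME WITH THE BARE `Classical.choose` DISPLAYED**: `K0⁷ ∧ K1⁸` ⟹ for every family `F` there are `K ≥ 1` and a point `V′` of the `dV₁`-NULL unit fibre with
`(Classical.choose ⟨HaveLebesgueDecomposition.lebesgue_decomposition⟩).2 V′ ≠ 0` — the second component of the pair Mathlib CHOOSES among all Lebesgue decompositions of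
`(jointLaw dU₀ M).fst` w.r.t. `dV₁` (§3 shows the same `∃`-statement has a witness `≡ 0` on that fibre).
[cite: Balaban1989LargeFieldII, Thm 1 p.355; Balaban1988Convergent, Cor. 3 (2.50) p.264, (3.1) p.264 (bookkeeping)] -/
theorem exists_choose_ne_zero_on_unitFibre_of_record13_of_stabilityBRunRows
    (h0 : Record13SepCoPHInhabited) (h1 : StabilityBRunRowsAtRecordR13SepCoPH) (F : T4Family) :
    ∃ K : ℕ, 1 ≤ K ∧ fieldMeasure (F.P K) 1 (SU 2) {V' : cfgOfRecord F 2 K 1 | (avOfRecord F 2 K 1).avg V' = 1} = 0 ∧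
      ∃ V' ∈ {V' : cfgOfRecord F 2 K 1 | (avOfRecord F 2 K 1).avg V' = 1},
        (Classical.choose
            (Measure.HaveLebesgueDecomposition.lebesgue_decomposition
              (μ := (jointLaw (fieldMeasure (F.P K) 0 (SU 2)) (avOfRecord F 2 K 0).avg).fst)
              (ν := fieldMeasure (F.P K) (0 + 1) (SU 2)))).2 V' ≠ 0 := by
  obtain ⟨K, hK, hnull, V', hV', hne⟩ := exists_avgDensity_ne_zero_on_unitFibre_of_record13_of_stabilityBRunRows h0 h1 F
  refine ⟨K, hK, hnull, V', hV', fun hz => hne ?_⟩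
  rw [avgDensity_avOfRecord_eq_choose, hz, ENNReal.toNNReal_zero]

/-- **★★★ ONE HYPOTHESIS ON THE VALUES OF `Classical.choose` REFUTES `K0⁷ ∧ K1⁸`** (the first two hypotheses of `Theses.BalabanUVNodes.closes`): if for SOME family `F` the
chosen level-0 → 1 densities `avgDensity (avOfRecord F 2 K 0).avg` vanish on the unit fibres `{V′ | (avOfRecord F 2 K 1).avg V′ = 1}` of all tori `K ≥ 1` — `dV₁`-NULL
sets on which the chosen-from `∃`-statement HAS vanishing witnesses (§3) — then `¬ (Record13SepCoPHInhabited ∧ StabilityBRunRowsAtRecordR13SepCoPH)`.  A hypothetical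
refutation MODULO a statement about `Classical.choose`; neither item is refuted outright.
[cite: Balaban1989LargeFieldII, Thm 1 p.355, (0.1) pp.355–356; Balaban1988Convergent, Cor. 3 (2.50) p.264 (bookkeeping)] -/
theorem not_record13_and_stabilityBRunRows_of_avgDensity_eq_zero_on_unitFibre
    (hV : ∃ F : T4Family, ∀ K : ℕ, 1 ≤ K →
      ∀ V' ∈ {V' : cfgOfRecord F 2 K 1 | (avOfRecord F 2 K 1).avg V' = 1}, avgDensity (avOfRecord F 2 K 0).avg V' = 0) :
    ¬ (Record13SepCoPHInhabited ∧ StabilityBRunRowsAtRecordR13SepCoPH) := by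
  rintro ⟨h0, h1⟩
  obtain ⟨F, hF⟩ := hV
  obtain ⟨K, hK, -, V', hV', hne⟩ := exists_avgDensity_ne_zero_on_unitFibre_of_record13_of_stabilityBRunRows h0 h1 F
  exact hne (hF K hK V' hV')

/-- **The K1⁸-alone form, modulo K0⁷'s conclusion at the family**: a family `F` carrying K0⁷'s conclusion (an admissible Stage-13 tuple with provisos, unity, slot
non-degeneracy) whose chosen level-0 → 1 densities vanish on the unit fibres refutes `StabilityBRunRowsAtRecordR13SepCoPH` (stmt-QuantumFields-26907).
[cite: Balaban1989LargeFieldII, Thm 1 p.355, (0.1) pp.355–356; Balaban1988Convergent, Cor. 3 (2.50) p.264 (bookkeeping)] -/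
theorem not_stabilityBRunRows_of_avgDensity_eq_zero_on_unitFibre
    (hV : ∃ F : T4Family,
      (∃ θ : Stage13HParams F 2, θ.Provisos₁₃SepCoPH F 2 ∧ (θ.ZhUnity F 2 ∧ θ.SlotsNondegenerate₁₃ F 2) ∧ θ.Admissible F 2) ∧
        ∀ K : ℕ, 1 ≤ K → ∀ V' ∈ {V' : cfgOfRecord F 2 K 1 | (avOfRecord F 2 K 1).avg V' = 1}, avgDensity (avOfRecord F 2 K 0).avg V' = 0) :
    ¬ StabilityBRunRowsAtRecordR13SepCoPH := by
  intro h1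
  obtain ⟨F, hK0, hF⟩ := hV
  obtain ⟨θ, h, -, hθ, hB, hW, -⟩ := h1 F hK0
  obtain ⟨K, hK, -, V', hV', hne⟩ := exists_avgDensity_ne_zero_on_unitFibre_of_endStatementBPrinted_of_window θ h hθ.ε₂₉_pos hB hW
  exact hne (hF K hK V' hV')

/-- **The K1⁷ form** (stmt-QuantumFields-20542, `aside` since rev 27; this lineage's key of record until gen 4): the same hypothesis refutes `StabilityBAtRecordR13SepCoPH`.
[cite: Balaban1989LargeFieldII, Thm 1 p.355, (0.1) pp.355–356; Balaban1988Convergent, Cor. 3 (2.50) p.264 (bookkeeping)] -/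
theorem not_stabilityBAtRecord_of_avgDensity_eq_zero_on_unitFibre
    (hV : ∃ F : T4Family,
      (∃ θ : Stage13HParams F 2, θ.Provisos₁₃SepCoPH F 2 ∧ (θ.ZhUnity F 2 ∧ θ.SlotsNondegenerate₁₃ F 2) ∧ θ.Admissible F 2) ∧
        ∀ K : ℕ, 1 ≤ K → ∀ V' ∈ {V' : cfgOfRecord F 2 K 1 | (avOfRecord F 2 K 1).avg V' = 1}, avgDensity (avOfRecord F 2 K 0).avg V' = 0) :
    ¬ StabilityBAtRecordR13SepCoPH := by
  intro h1
  obtain ⟨F, hK0, hF⟩ := hV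
  obtain ⟨θ, P, hK, hne⟩ := exists_avgDensity_ne_zero_of_stabilityBAtRecordR13SepCoPH h1 F hK0
  exact hne (hF P.K hK _ (critCfgOfRecord_mem_preimage_avg_one F θ.ν P.K hK))

/-- **★★ THE TWO REGISTERED STUB TEXTS OF K1⁸'s SKELETON JOINTLY INHERIT THE PIN**: `stub_nodes13PWS`'s text `∀ F, Inhabited13 F → NodesAtSomeRecord13PWS F` and
`stub_runRows13PWS`'s text `∀ F, NodesAtSomeRecord13PWS F → RunRowsAtSomeRecord13PWS F` (K1 v6 = v7ᴿ byte-identical; tree names of dag-n24-w1's `K1V6Defs`) compose to K1⁷ BY NAME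
(`K1V6Defs.stabilityBAtRecordR13SepCoPH_of_stubTexts`); so a family with `Inhabited13 F` whose chosen level-0 → 1 densities vanish on the unit fibres refutes their CONJUNCTION.
(Which of the two texts carries the pin is not decided here: the window comes from the run rows, the (B) lower half from the nodes.)
[cite: Balaban1989LargeFieldII, Thm 1 p.355 + (0.1) pp.355–356; Balaban1987RG1, Thm 3 p.264; Balaban1988Convergent, Cor. 3 (2.50) p.264 (bookkeeping)] -/
theorem not_stubTexts_of_avgDensity_eq_zero_on_unitFibre
    (hV : ∃ F : T4Family, Summit.QuantumFields.YangMills.Theorems.K1V6Defs.Inhabited13 F ∧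
      ∀ K : ℕ, 1 ≤ K → ∀ V' ∈ {V' : cfgOfRecord F 2 K 1 | (avOfRecord F 2 K 1).avg V' = 1}, avgDensity (avOfRecord F 2 K 0).avg V' = 0) :
    ¬ ((∀ F : T4Family, Summit.QuantumFields.YangMills.Theorems.K1V6Defs.Inhabited13 F →
          Summit.QuantumFields.YangMills.Theorems.K1V6Defs.NodesAtSomeRecord13PWS F) ∧
       (∀ F : T4Family, Summit.QuantumFields.YangMills.Theorems.K1V6Defs.NodesAtSomeRecord13PWS F →
          Summit.QuantumFields.YangMills.Theorems.K1V6Defs.RunRowsAtSomeRecord13PWS F)) := by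
  rintro ⟨h₁, h₂⟩
  exact not_stabilityBAtRecord_of_avgDensity_eq_zero_on_unitFibre hV
    (Summit.QuantumFields.YangMills.Theorems.K1V6Defs.stabilityBAtRecordR13SepCoPH_of_stubTexts h₁ h₂)

end Items

end Summit.QuantumFields.YangMills.BalabanUVNodes.K1R8VersionPinOnNullUnitFibre

end
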